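import Summits.AtomisticToContinuum.HydrodynamicLimit.Theorems.CollisionIsometryCLTTransferIsometry

/-!
# The velocity transfer as an orthogonal matrix: inner products, Gram identities, column budget,
# block expansion (helpers for `TransferIsometry`, item stmt-AtomisticToContinuum-12951)

`Theorems/CollisionIsometryCLTTransferIsometry.lean` proves the route support item
`TransferIsometry`: the frozen-geometry velocity transfer `transfer σ N y Δ` (the crux files'
`let M`) is additive, homogeneous, preserves `∑ i, ‖W i‖²`, and has row weight `3`. This file turns
those four facts into the matrix vocabulary the crux lines of `DiffuseBackwardInfluence` and
`AdaptedWeightCLT` speak (`vᵢ(s) = Σₖ M_ik vₖ(s−Δ)`, `M Mᵀ = Mᵀ M = I`), first for an ARBITRARY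
additive / homogeneous / `ℓ²`-norm-preserving self-map `g` of `ι → ℝ^m` (`ι`, `m` finite), then
for `transfer`:

* `sum_inner_eq` — polarization: `Σᵢ ⟪g W₁ i, g W₂ i⟫ = Σᵢ ⟪W₁ i, W₂ i⟫`;
* `colGram_eq`, `colWeight_eq_card` — the columns `g (e_k ⊗ e_a)` are orthonormal (`Mᵀ M = I`),
  in particular every column has weight `Σ_{i,b} (g (e_k ⊗ e_a)) i b ² = 1` and every block column
  Frobenius weight `Σᵢ ‖M_ik‖_F² = card m`;
* `rowGram_eq` — the rows are orthonormal (`M Mᵀ = I`: a linear isometry of a finite-dimensional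
  Hilbert space is unitary; transport to `PiLp 2`, `LinearIsometry.toLinearIsometryEquiv`);
* `apply_eq_sum_single` — block expansion `g W i = Σₖ Σₐ (W k a) • g (e_k ⊗ e_a) i`;
* the same for `transfer σ N y Δ` (`sum_inner_transfer`, `colGram_transfer`, `colWeight_transfer`,
  `rowGram_transfer`, `transfer_apply_eq_sum_single`) and the linear bookkeeping
  `transfer_zero / transfer_neg / transfer_sub / transfer_sum`.

References: C. Cercignani, R. Illner, M. Pulvirenti, *The Mathematical Theory of Dilute Gases*
(1994), §4.2 (the collision map is a linear isometry of velocity space).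
-/

noncomputable section

namespace Summit.AtomisticToContinuum.HydrodynamicLimit.Theorems.TransferIsometry

open scoped BigOperators InnerProductSpace
open Summit.AtomisticToContinuum.HydrodynamicLimit.Theorems.DiffuseBackwardInfluenceNeg
  (V3 Cfg transfer)

/-! ## §1 Generic: additive, homogeneous, `ℓ²`-norm-preserving self-maps of `ι → ℝ^m` -/

section Generic

variable {ι m : Type*} [Fintype ι] [DecidableEq ι] [Fintype m] [DecidableEq m]
  (g : (ι → EuclideanSpace ℝ m) → (ι → EuclideanSpace ℝ m))

omit [DecidableEq ι] [DecidableEq m] in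
/-- **Polarization**: an additive map of `ι → ℝ^m` preserving `∑ i, ‖W i‖²` preserves the `ℓ²`
inner product `∑ i, ⟪W₁ i, W₂ i⟫`. [folklore] -/
theorem sum_inner_eq (hadd : ∀ W₁ W₂, g (W₁ + W₂) = g W₁ + g W₂)
    (hnorm : ∀ W, ∑ i, ‖g W i‖ ^ 2 = ∑ i, ‖W i‖ ^ 2) (W₁ W₂ : ι → EuclideanSpace ℝ m) :
    ∑ i, ⟪g W₁ i, g W₂ i⟫_ℝ = ∑ i, ⟪W₁ i, W₂ i⟫_ℝ := by
  have key : ∀ U₁ U₂ : ι → EuclideanSpace ℝ m, ∑ i, ⟪U₁ i, U₂ i⟫_ℝ =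
      ((∑ i, ‖(U₁ + U₂) i‖ ^ 2) - (∑ i, ‖U₁ i‖ ^ 2) - ∑ i, ‖U₂ i‖ ^ 2) / 2 := by
    intro U₁ U₂
    rw [eq_div_iff two_ne_zero, Finset.sum_mul, ← Finset.sum_sub_distrib,
      ← Finset.sum_sub_distrib]
    refine Finset.sum_congr rfl fun i _ => ?_
    rw [Pi.add_apply, norm_add_sq_real]
    ring
  rw [key, key W₁ W₂, ← hadd, hnorm, hnorm, hnorm]

/-- **Columns are orthonormal** (`Mᵀ M = I`): for an additive `ℓ²`-norm-preserving `g`,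
`∑ i, ⟪g (e_k ⊗ e_a) i, g (e_k' ⊗ e_a') i⟫ = δ_{kk'} δ_{aa'}` (written as the `(k, a)` coordinate
of `e_k' ⊗ e_a'`). [folklore] -/
theorem colGram_eq (hadd : ∀ W₁ W₂, g (W₁ + W₂) = g W₁ + g W₂)
    (hnorm : ∀ W, ∑ i, ‖g W i‖ ^ 2 = ∑ i, ‖W i‖ ^ 2) (k k' : ι) (a a' : m) :
    ∑ i, ⟪g (Pi.single k (EuclideanSpace.single a (1 : ℝ))) i,
        g (Pi.single k' (EuclideanSpace.single a' (1 : ℝ))) i⟫_ℝ =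
      (Pi.single k' (EuclideanSpace.single a' (1 : ℝ)) : ι → EuclideanSpace ℝ m) k a := by
  rw [sum_inner_eq g hadd hnorm, Finset.sum_eq_single k]
  · rw [Pi.single_eq_same, EuclideanSpace.inner_single_left, map_one, one_mul]
  · intro i _ hi
    rw [Pi.single_eq_of_ne hi, inner_zero_left]
  · exact fun h => absurd (Finset.mem_univ k) h

/-- **Column weight** of an `ℓ²`-norm-preserving self-map of `ι → ℝ^m`: for every column `k`,
`∑ i a, ‖g (e_k ⊗ e_a) i‖² = card m` — each `g (e_k ⊗ e_a)` is a unit vector (neither additivity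
nor homogeneity is needed). [folklore] -/
theorem colWeight_eq_card (hnorm : ∀ W, ∑ i, ‖g W i‖ ^ 2 = ∑ i, ‖W i‖ ^ 2) (k : ι) :
    ∑ i, ∑ a, ‖g (Pi.single k (EuclideanSpace.single a (1 : ℝ))) i‖ ^ 2 = Fintype.card m := by
  have h : ∀ a : m, ∑ i, ‖g (Pi.single k (EuclideanSpace.single a (1 : ℝ))) i‖ ^ 2 = 1 := by
    intro a
    rw [hnorm, Finset.sum_eq_single k]
    · rw [Pi.single_eq_same, PiLp.norm_single, norm_one, one_pow]
    · intro i _ hi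
      rw [Pi.single_eq_of_ne hi, norm_zero, zero_pow two_ne_zero]
    · exact fun hk => absurd (Finset.mem_univ k) hk
  rw [Finset.sum_comm, Finset.sum_congr rfl fun a _ => h a]
  simp

/-- **Rows are orthonormal** (`M Mᵀ = I`): for an additive, homogeneous, `ℓ²`-norm-preserving
self-map `g` of `ι → ℝ^m` (`ι`, `m` finite),
`∑ k a, (g (e_k ⊗ e_a)) i b · (g (e_k ⊗ e_a)) j c = δ_{ij} δ_{bc}` (written as the `(i, b)`
coordinate of `e_j ⊗ e_c`): a linear isometry of a finite-dimensional Hilbert space is unitary.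
[folklore] -/
theorem rowGram_eq (hadd : ∀ W₁ W₂, g (W₁ + W₂) = g W₁ + g W₂)
    (hsmul : ∀ (c : ℝ) W, g (c • W) = c • g W)
    (hnorm : ∀ W, ∑ i, ‖g W i‖ ^ 2 = ∑ i, ‖W i‖ ^ 2) (i j : ι) (b c : m) :
    ∑ k, ∑ a, g (Pi.single k (EuclideanSpace.single a (1 : ℝ))) i b *
        g (Pi.single k (EuclideanSpace.single a (1 : ℝ))) j c =
      (Pi.single j (EuclideanSpace.single c (1 : ℝ)) : ι → EuclideanSpace ℝ m) i b := by
  -- transport `g` to the Hilbert space `V = PiLp 2 (ι → ℝ^m)` (as in `rowWeight_eq_card`)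
  let V := PiLp 2 (fun _ : ι => EuclideanSpace ℝ m)
  let Lₗ : V →ₗ[ℝ] V :=
    { toFun := fun W => WithLp.toLp 2 (g (WithLp.ofLp W))
      map_add' := fun W₁ W₂ => by rw [WithLp.ofLp_add, hadd, WithLp.toLp_add]
      map_smul' := fun c W => by rw [WithLp.ofLp_smul, hsmul, WithLp.toLp_smul, RingHom.id_apply] }
  have hLnorm : ∀ W : V, ‖Lₗ W‖ = ‖W‖ := fun W => by
    have h2 : ‖Lₗ W‖ ^ 2 = ‖W‖ ^ 2 := by
      rw [PiLp.norm_sq_eq_of_L2, PiLp.norm_sq_eq_of_L2]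
      exact hnorm (WithLp.ofLp W)
    rw [← Real.sqrt_sq (norm_nonneg (Lₗ W)), h2, Real.sqrt_sq (norm_nonneg W)]
  let Li : V →ₗᵢ[ℝ] V := { toLinearMap := Lₗ, norm_map' := hLnorm }
  let L : V ≃ₗᵢ[ℝ] V := Li.toLinearIsometryEquiv rfl
  let e : ι → m → V := fun k a => WithLp.toLp 2 (Pi.single k (EuclideanSpace.single a (1 : ℝ)))
  have he : ∀ k a (Y : V), ⟪e k a, Y⟫_ℝ = Y k a := by
    intro k a Y
    rw [PiLp.inner_apply, Finset.sum_eq_single k]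
    · simp [e, EuclideanSpace.inner_single_left]
    · intro j _ hj
      simp [e, Pi.single_eq_of_ne hj]
    · exact fun h => absurd (Finset.mem_univ k) h
  have h1 : ∀ k a (i' : ι) (b' : m), g (Pi.single k (EuclideanSpace.single a (1 : ℝ))) i' b' =
      ⟪e k a, L.symm (e i' b')⟫_ℝ := fun k a i' b' =>
    calc g (Pi.single k (EuclideanSpace.single a (1 : ℝ))) i' b' = (L (e k a)) i' b' := rfl
      _ = ⟪e i' b', L (e k a)⟫_ℝ := (he i' b' (L (e k a))).symm
      _ = ⟪L (e k a), e i' b'⟫_ℝ := real_inner_comm _ _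
      _ = ⟪e k a, L.symm (e i' b')⟫_ℝ := L.inner_map_eq_flip _ _
  -- coordinates: `Σ_{k,a} Y k a · Z k a = ⟪Y, Z⟫`
  have h2 : ∀ Y Z : V, ∑ k, ∑ a, Y k a * Z k a = ⟪Y, Z⟫_ℝ := by
    intro Y Z
    rw [PiLp.inner_apply]
    refine Finset.sum_congr rfl fun k _ => ?_
    rw [PiLp.inner_apply]
    refine Finset.sum_congr rfl fun a _ => ?_
    simp [mul_comm]
  simp_rw [h1, he]
  rw [h2, LinearIsometryEquiv.inner_map_map, he]

/-- **Block expansion**: an additive homogeneous self-map of `ι → ℝ^m` is given by its matrix,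
`g W i = ∑ k a, (W k a) • g (e_k ⊗ e_a) i` (`vᵢ' = Σₖ M_ik vₖ`). [folklore] -/
theorem apply_eq_sum_single (hadd : ∀ W₁ W₂, g (W₁ + W₂) = g W₁ + g W₂)
    (hsmul : ∀ (c : ℝ) W, g (c • W) = c • g W) (W : ι → EuclideanSpace ℝ m) (i : ι) :
    g W i = ∑ k, ∑ a, W k a • g (Pi.single k (EuclideanSpace.single a (1 : ℝ))) i := by
  let Lg : (ι → EuclideanSpace ℝ m) →ₗ[ℝ] (ι → EuclideanSpace ℝ m) :=
    { toFun := g, map_add' := hadd, map_smul' := hsmul }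
  let B := Pi.basis fun _ : ι => (EuclideanSpace.basisFun m ℝ).toBasis
  have hB : ∀ k a, B ⟨k, a⟩ = Pi.single k (EuclideanSpace.single a (1 : ℝ)) := by
    intro k a
    simp [B]
  have hr : ∀ k a, B.repr W ⟨k, a⟩ = W k a := by
    intro k a
    simp [B]
  calc g W i = Lg W i := rfl
    _ = Lg (∑ x, B.repr W x • B x) i := by rw [B.sum_repr]
    _ = ∑ x : (Σ _ : ι, m), B.repr W x • g (B x) i := by
        rw [map_sum, Finset.sum_apply]
        refine Finset.sum_congr rfl fun x _ => ?_
        rw [map_smul, Pi.smul_apply]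
        rfl
    _ = ∑ k, ∑ a, W k a • g (Pi.single k (EuclideanSpace.single a (1 : ℝ))) i := by
        rw [Fintype.sum_sigma]
        simp only [hB, hr]

end Generic

/-! ## §2 The crux's transfer -/

section Transfer

variable (σ : ℝ) (N : ℕ) (y : Cfg N) (Δ : ℝ)

/-- The velocity transfer kills `0`. [folklore] -/
theorem transfer_zero : transfer σ N y Δ 0 = 0 := by
  have h := transfer_smul σ N y Δ 0 0
  rwa [zero_smul, zero_smul] at h

/-- The velocity transfer commutes with negation. [folklore] -/
theorem transfer_neg (W : Fin (N + 1) → V3) : transfer σ N y Δ (-W) = -transfer σ N y Δ W := by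
  have h := transfer_smul σ N y Δ (-1) W
  rwa [neg_one_smul, neg_one_smul] at h

/-- The velocity transfer is subtractive. [folklore] -/
theorem transfer_sub (W₁ W₂ : Fin (N + 1) → V3) :
    transfer σ N y Δ (W₁ - W₂) = transfer σ N y Δ W₁ - transfer σ N y Δ W₂ := by
  rw [sub_eq_add_neg, transfer_add, transfer_neg, ← sub_eq_add_neg]

/-- The velocity transfer of a finite sum. [folklore] -/
theorem transfer_sum {α : Type*} (s : Finset α) (f : α → Fin (N + 1) → V3) :
    transfer σ N y Δ (∑ x ∈ s, f x) = ∑ x ∈ s, transfer σ N y Δ (f x) := by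
  let Lg : (Fin (N + 1) → V3) →ₗ[ℝ] (Fin (N + 1) → V3) :=
    { toFun := transfer σ N y Δ, map_add' := transfer_add σ N y Δ,
      map_smul' := transfer_smul σ N y Δ }
  exact map_sum Lg f s

/-- **The transfer preserves the `ℓ²` inner product**: `Σᵢ ⟪M W₁ i, M W₂ i⟫ = Σᵢ ⟪W₁ i, W₂ i⟫`.
[folklore] -/
theorem sum_inner_transfer (W₁ W₂ : Fin (N + 1) → V3) :
    ∑ i, ⟪transfer σ N y Δ W₁ i, transfer σ N y Δ W₂ i⟫_ℝ = ∑ i, ⟪W₁ i, W₂ i⟫_ℝ :=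
  sum_inner_eq (transfer σ N y Δ) (transfer_add σ N y Δ) (sum_norm_sq_transfer σ N y Δ) W₁ W₂

/-- **Columns of the transfer are orthonormal** (`Mᵀ M = I`). [folklore] -/
theorem colGram_transfer (k k' : Fin (N + 1)) (a a' : Fin 3) :
    ∑ i, ⟪transfer σ N y Δ (Pi.single k (EuclideanSpace.single a (1 : ℝ))) i,
        transfer σ N y Δ (Pi.single k' (EuclideanSpace.single a' (1 : ℝ))) i⟫_ℝ =
      (Pi.single k' (EuclideanSpace.single a' (1 : ℝ)) : Fin (N + 1) → V3) k a :=
  colGram_eq (transfer σ N y Δ) (transfer_add σ N y Δ) (sum_norm_sq_transfer σ N y Δ) k k' a a'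

/-- **Column budget of the transfer**: every column has Frobenius weight
`∑ i, ‖M_ik‖_F² = ∑ i a, ‖M (e_k ⊗ e_a) i‖² = 3` (with the row budget `rowWeight_transfer`, the
block weights `‖M_ik‖_F² / 3` form a doubly stochastic matrix). [folklore] -/
theorem colWeight_transfer (k : Fin (N + 1)) :
    ∑ i : Fin (N + 1), ∑ a : Fin 3,
      ‖transfer σ N y Δ (Pi.single k (EuclideanSpace.single a (1 : ℝ))) i‖ ^ 2 = 3 := by
  have h := colWeight_eq_card (transfer σ N y Δ) (sum_norm_sq_transfer σ N y Δ) k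
  rwa [Fintype.card_fin, Nat.cast_ofNat] at h

/-- **Rows of the transfer are orthonormal** (`M Mᵀ = I`):
`∑ k a, (M (e_k ⊗ e_a)) i b · (M (e_k ⊗ e_a)) j c = δ_{ij} δ_{bc}`. [folklore] -/
theorem rowGram_transfer (i j : Fin (N + 1)) (b c : Fin 3) :
    ∑ k : Fin (N + 1), ∑ a : Fin 3,
        transfer σ N y Δ (Pi.single k (EuclideanSpace.single a (1 : ℝ))) i b *
          transfer σ N y Δ (Pi.single k (EuclideanSpace.single a (1 : ℝ))) j c =
      (Pi.single j (EuclideanSpace.single c (1 : ℝ)) : Fin (N + 1) → V3) i b :=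
  rowGram_eq (transfer σ N y Δ) (transfer_add σ N y Δ) (transfer_smul σ N y Δ)
    (sum_norm_sq_transfer σ N y Δ) i j b c

/-- **Block expansion of the transfer**: `(M W) i = ∑ k a, (W k a) • M (e_k ⊗ e_a) i`, i.e.
`vᵢ(Δ) = Σₖ M_ik vₖ(0)` with the `3 × 3` blocks `M_ik = (a ↦ M (e_k ⊗ e_a) i)`. [folklore] -/
theorem transfer_apply_eq_sum_single (W : Fin (N + 1) → V3) (i : Fin (N + 1)) :
    transfer σ N y Δ W i =
      ∑ k : Fin (N + 1), ∑ a : Fin 3,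
        W k a • transfer σ N y Δ (Pi.single k (EuclideanSpace.single a (1 : ℝ))) i :=
  apply_eq_sum_single (transfer σ N y Δ) (transfer_add σ N y Δ) (transfer_smul σ N y Δ) W i

end Transfer

end Summit.AtomisticToContinuum.HydrodynamicLimit.Theorems.TransferIsometry

end
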